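import Literature.Geometry.Lorentzian.StationaryOrbitQuotientMetric
import HarnessLib

/-!
# The quotient metric `g_S` is smooth: its coordinate expression in every slice chart is `C^∞`
(Anderson 2000, §0: "`g_M` restricted to the horizontal subspaces … induces a Riemannian metric
`g_S` on `S`" — the smoothness clause)

For the orbit space `S = OrbitSpace X` of a chronological stationary spacetime with its slice
charts (`StationaryOrbitSpaceManifold.lean`) and the pointwise quotient metric
`g_S(z)(ζ, ζ') = g(H ζ, H ζ')` (`StationaryOrbitQuotientMetric.lean`), the coordinate expression of
`g_S` in a slice chart `e` (inverse `e⁻¹ = π ∘ σ`, `σ` the slice parametrisation) on the frame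
pushed forward from `ℝ³`, `u ↦ g_S(e⁻¹ u)(d(e⁻¹)_u a, d(e⁻¹)_u b)`, equals Geroch's orbit form along
the slice, `u ↦ h_{σ(u)}(dσ_u a, dσ_u b)` with `h = g − λ⁻¹ X♭ ⊗ X♭`
(`quotientMetricVal_mfderiv_orbitProj`), and is therefore `C^∞` on the chart target. This is the
content of "`g_S` is a (smooth) Riemannian metric on `S`" read in charts; the packaging of `g_S` as a
section of the bundle of bilinear forms over `S` is not done here.

* `contMDiffOn_totalSpace_mfderiv_const` — for a `C^n` map `σ` from an open set of a normed space
  into a manifold, `u ↦ (σ u, dσ_u a)` is a `C^m` map into the tangent bundle (`m + 1 ≤ n`)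
  (Mathlib's `ContMDiffWithinAt.mfderivWithin_const` and `clm_apply_of_inCoordinates`, as in
  `ContMDiffOn.contMDiffOn_tangentMapWithin`);
* `PseudoRiemannianMetric.contMDiffWithinAt_val_apply_along` — `u ↦ g_{σ u}(A u, B u)` is `C^m`
  for `C^m` sections `A, B` of `TM` along `σ` (`ContMDiffWithinAt.clm_bundle_apply₂` with a base
  map);
* `PseudoRiemannianMetric.contMDiffOn_orbitBilin_mfderiv` — **Geroch's form along a smooth map is
  smooth**: `u ↦ h_{σ u}(dσ_u a, dσ_u b)` is `C^∞` where `g(K, K) ≠ 0` along `σ`;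
* `Spacetime.IsStationaryKilling.quotientMetricVal_chart_symm` — the coordinate expression of
  `g_S` in a slice chart is Geroch's form along the slice;
* `Spacetime.IsStationaryKilling.contMDiffOn_quotientMetricVal_chart_symm` — **it is `C^∞` on the
  chart target** (Anderson 2000, §0).

Everything is proved; no definitions, no named facts.

## References

* M. T. Anderson, Ann. Henri Poincaré 1 (2000) 977–994, arXiv:gr-qc/0001091, §0 (key
  `Anderson2000`).
* R. Geroch, J. Math. Phys. 12 (1971) 918–924, App. A (key `Geroch1971`).
-/

noncomputable section

open Bundle Set Filter Function Manifold TopologicalSpace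
open scoped ContDiff Topology Manifold

namespace Literature.Geometry.Lorentzian

/-! ### Sections of `TM` along a map from a normed space -/

section AlongMap

variable {E : Type*} [NormedAddCommGroup E] [NormedSpace ℝ E] {H : Type*} [TopologicalSpace H]
  {I : ModelWithCorners ℝ E H} {M : Type*} [TopologicalSpace M] [ChartedSpace H M]
  [IsManifold I ∞ M] {F' : Type*} [NormedAddCommGroup F'] [NormedSpace ℝ F']

/-- **The pushforward of a constant vector along a `C^n` map is a `C^m` section of `TM` along the
map** (`m + 1 ≤ n`): for `σ` of class `C^n` on an open set `s` of a normed space and `a ∈ F'`,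
`u ↦ (σ u, dσ_u a) ∈ TM` is `C^m` on `s` (Mathlib's `ContMDiffWithinAt.mfderivWithin_const` read
through `ContMDiffWithinAt.clm_apply_of_inCoordinates`, the argument of
`ContMDiffOn.contMDiffOn_tangentMapWithin`). [folklore] -/
theorem contMDiffOn_totalSpace_mfderiv_const {σ : F' → M} {s : Set F'} (hs : IsOpen s)
    {m n : ℕ∞ω} (hσ : ContMDiffOn 𝓘(ℝ, F') I n σ s) (hmn : m + 1 ≤ n) (a : F') :
    ContMDiffOn 𝓘(ℝ, F') I.tangent m
      (fun u ↦ (TotalSpace.mk' E (σ u) (mfderiv 𝓘(ℝ, F') I σ u a) : TangentBundle I M)) s := by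
  intro u hu
  have hsU : UniqueMDiffOn 𝓘(ℝ, F') s := hs.uniqueMDiffOn
  have hϕ := (hσ u hu).mfderivWithin_const hmn hu hsU
  have hv : ContMDiffWithinAt 𝓘(ℝ, F') 𝓘(ℝ, F').tangent m
      (fun u : F' ↦ (TotalSpace.mk' F' u a : TangentBundle 𝓘(ℝ, F') F')) s u :=
    contMDiffWithinAt_vectorSpace_iff_contDiffWithinAt.2 contDiffWithinAt_const
  have hb₂ : ContMDiffWithinAt 𝓘(ℝ, F') I m σ s u := (hσ u hu).of_le (le_self_add.trans hmn)
  have key := ContMDiffWithinAt.clm_apply_of_inCoordinates (F₁ := F') (F₂ := E)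
    (E₁ := TangentSpace 𝓘(ℝ, F')) (E₂ := TangentSpace I) (b₁ := id) (b₂ := σ)
    (ϕ := fun y ↦ mfderivWithin 𝓘(ℝ, F') I σ s y) (v := fun _ ↦ a) hϕ hv hb₂
  refine key.congr (fun y hy ↦ ?_) ?_
  · rw [mfderivWithin_of_isOpen hs hy]
    rfl
  · rw [mfderivWithin_of_isOpen hs hu]
    rfl

/-- A `C^n` vector field composed with a `C^m` map is a `C^m` section of `TM` along the map
(`m ≤ n`). [folklore] -/
theorem contMDiffOn_totalSpace_comp {σ : F' → M} {s : Set F'} {m n : ℕ∞ω}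
    (hσ : ContMDiffOn 𝓘(ℝ, F') I m σ s) {K : Π x : M, TangentSpace I x} (hK : CMDiff n (T% K))
    (hmn : m ≤ n) :
    ContMDiffOn 𝓘(ℝ, F') I.tangent m
      (fun u ↦ (TotalSpace.mk' E (σ u) (K (σ u)) : TangentBundle I M)) s :=
  (hK.of_le hmn).comp_contMDiffOn hσ

namespace PseudoRiemannianMetric

variable {n : ℕ∞ω} (g : PseudoRiemannianMetric I n E (TangentSpace I : M → Type _))

/-- **The metric on sections along a map**: if `σ` is `C^m` within `s` at `u` and `A, B` are `C^m`
sections of `TM` along `σ` (maps `u ↦ (σ u, A u)` into the tangent bundle), then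
`u ↦ g_{σ u}(A u, B u)` is `C^m` within `s` at `u` (`m ≤ n`) — Mathlib's
`ContMDiffWithinAt.clm_bundle_apply₂` with a base map, as in `ContMDiffWithinAt.inner_bundle`.
[folklore] -/
theorem contMDiffWithinAt_val_apply_along {m : ℕ∞ω} (hm : m ≤ n) {σ : F' → M} {s : Set F'}
    {u : F'} {A B : Π u : F', TangentSpace I (σ u)} (hσ : ContMDiffWithinAt 𝓘(ℝ, F') I m σ s u)
    (hA : ContMDiffWithinAt 𝓘(ℝ, F') I.tangent m
      (fun u ↦ (TotalSpace.mk' E (σ u) (A u) : TangentBundle I M)) s u)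
    (hB : ContMDiffWithinAt 𝓘(ℝ, F') I.tangent m
      (fun u ↦ (TotalSpace.mk' E (σ u) (B u) : TangentBundle I M)) s u) :
    ContMDiffWithinAt 𝓘(ℝ, F') 𝓘(ℝ, ℝ) m (fun u ↦ g.val (σ u) (A u) (B u)) s u := by
  have hg : ContMDiffWithinAt 𝓘(ℝ, F') (I.prod 𝓘(ℝ, E →L[ℝ] E →L[ℝ] ℝ)) m
      (fun u ↦ TotalSpace.mk' (E →L[ℝ] E →L[ℝ] ℝ)
        (E := fun x : M ↦ TangentSpace I x →L[ℝ] TangentSpace I x →L[ℝ] ℝ) (σ u)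
        (g.val (σ u))) s u :=
    ((g.contMDiff (σ u)).of_le hm).comp_contMDiffWithinAt u hσ
  have : ContMDiffWithinAt 𝓘(ℝ, F') (I.prod 𝓘(ℝ, ℝ)) m
      (fun u ↦ TotalSpace.mk' ℝ (E := Bundle.Trivial M ℝ) (σ u) (g.val (σ u) (A u) (B u))) s u := by
    apply ContMDiffWithinAt.clm_bundle_apply₂ (F₁ := E) (F₂ := E)
    · exact hg
    · exact hA
    · exact hB
  simp only [contMDiffWithinAt_totalSpace] at this
  exact this.2

/-- **Geroch's orbit form along a smooth map is smooth.** For a `C^∞` map `σ` on an open set `s`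
of a normed space, a `C^∞` vector field `K` with `g(K, K) ≠ 0` along `σ`, and `a, b ∈ F'`, the
function `u ↦ h_{σ u}(dσ_u a, dσ_u b)`, `h = g − λ⁻¹ K♭ ⊗ K♭` (`orbitBilin`, Geroch 1971, App. A), is
`C^∞` on `s` (the metric `g` is `C^∞`). [cite: Geroch1971, App. A] -/
theorem contMDiffOn_orbitBilin_mfderiv (g : PseudoRiemannianMetric I ∞ E (TangentSpace I : M → Type _))
    {σ : F' → M} {s : Set F'} (hs : IsOpen s) (hσ : ContMDiffOn 𝓘(ℝ, F') I ∞ σ s)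
    {K : Π x : M, TangentSpace I x} (hK : CMDiff ∞ (T% K))
    (hKK : ∀ u ∈ s, g.sqNorm K (σ u) ≠ 0) (a b : F') :
    ContMDiffOn 𝓘(ℝ, F') 𝓘(ℝ, ℝ) ∞
      (fun u ↦ g.orbitBilin K (σ u) (mfderiv 𝓘(ℝ, F') I σ u a) (mfderiv 𝓘(ℝ, F') I σ u b)) s := by
  have hle : (∞ : ℕ∞ω) + 1 ≤ ∞ := by simp
  have hA := contMDiffOn_totalSpace_mfderiv_const hs hσ hle a
  have hB := contMDiffOn_totalSpace_mfderiv_const hs hσ hle b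
  have hKσ := contMDiffOn_totalSpace_comp hσ hK le_rfl
  -- the scalar ingredients
  have h1 : ContMDiffOn 𝓘(ℝ, F') 𝓘(ℝ, ℝ) ∞
      (fun u ↦ g.val (σ u) (mfderiv 𝓘(ℝ, F') I σ u a) (mfderiv 𝓘(ℝ, F') I σ u b)) s :=
    fun u hu ↦ g.contMDiffWithinAt_val_apply_along le_rfl (hσ u hu) (hA u hu) (hB u hu)
  have h2 : ContMDiffOn 𝓘(ℝ, F') 𝓘(ℝ, ℝ) ∞
      (fun u ↦ g.val (σ u) (K (σ u)) (mfderiv 𝓘(ℝ, F') I σ u a)) s :=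
    fun u hu ↦ g.contMDiffWithinAt_val_apply_along le_rfl (hσ u hu) (hKσ u hu) (hA u hu)
  have h3 : ContMDiffOn 𝓘(ℝ, F') 𝓘(ℝ, ℝ) ∞
      (fun u ↦ g.val (σ u) (K (σ u)) (mfderiv 𝓘(ℝ, F') I σ u b)) s :=
    fun u hu ↦ g.contMDiffWithinAt_val_apply_along le_rfl (hσ u hu) (hKσ u hu) (hB u hu)
  have h4 : ContMDiffOn 𝓘(ℝ, F') 𝓘(ℝ, ℝ) ∞ (fun u ↦ g.val (σ u) (K (σ u)) (K (σ u))) s :=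
    fun u hu ↦ g.contMDiffWithinAt_val_apply_along le_rfl (hσ u hu) (hKσ u hu) (hKσ u hu)
  rw [contMDiffOn_iff_contDiffOn] at h1 h2 h3 h4 ⊢
  have h5 : ContDiffOn ℝ ∞ (fun u ↦ (g.val (σ u) (K (σ u)) (K (σ u)))⁻¹) s :=
    h4.inv (fun u hu ↦ hKK u hu)
  have := (h1.sub ((h5.mul h2).mul h3))
  refine this.congr (fun u _ ↦ ?_)
  rw [orbitBilin_apply, sqNorm_apply]

end PseudoRiemannianMetric

end AlongMap

/-! ### The coordinate expression of `g_S` in a slice chart -/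

namespace Spacetime

universe u

variable {𝓢 : Spacetime.{u} 4} [𝓢.metric.HasLeviCivita]
  {X : Π x : 𝓢.carrier, TangentSpace (𝓡 4) x}

/-- **`g_S` in a slice chart is Geroch's form along the slice.** Let `d` be slice data at `p` for
the stationary flow, with chart `e` (`e⁻¹ = π ∘ σ`, `σ = d.param`, on the chart domain `d.dom`).
For `u ∈ d.dom` and `a, b ∈ ℝ³`,
`g_S(e⁻¹ u)(d(e⁻¹)_u a, d(e⁻¹)_u b) = h_{σ u}(dσ_u a, dσ_u b)` (chain rule `d(e⁻¹) = dπ ∘ dσ` and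
`quotientMetricVal_mfderiv_orbitProj`). [cite: Anderson2000, §0] -/
theorem IsStationaryKilling.quotientMetricVal_chart_symm (hX : 𝓢.IsStationaryKilling X univ)
    (hchr : 𝓢.metric.IsChronological 𝓢.timeOrientation) {p : 𝓢.carrier}
    (d : LorentzianMetric.SliceData X hX.flow (EuclideanSpace ℝ (Fin 3)) p)
    {u : EuclideanSpace ℝ (Fin 3)} (hu : u ∈ d.dom) (a b : EuclideanSpace ℝ (Fin 3)) :
    letI := hX.orbitSpaceChartedSpace hchr
    hX.quotientMetricVal hchr
        ((d.chart hX.contMDiff_one hX.isMIntegralCurve_flow hX.flow_zero).symm u)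
        (mfderiv (𝓡 3) (𝓡 3) (d.chart hX.contMDiff_one hX.isMIntegralCurve_flow hX.flow_zero).symm
          u a)
        (mfderiv (𝓡 3) (𝓡 3) (d.chart hX.contMDiff_one hX.isMIntegralCurve_flow hX.flow_zero).symm
          u b) =
      𝓢.metric.toPseudoRiemannianMetric.orbitBilin X (d.param u)
        (mfderiv (𝓡 3) (𝓡 4) d.param u a) (mfderiv (𝓡 3) (𝓡 4) d.param u b) := by
  letI := hX.orbitSpaceChartedSpace hchr
  have hfun : ((d.chart hX.contMDiff_one hX.isMIntegralCurve_flow hX.flow_zero).symm :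
      EuclideanSpace ℝ (Fin 3) → OrbitSpace X) = orbitProj X ∘ d.param := rfl
  have hπ : MDifferentiableAt (𝓡 4) (𝓡 3) (orbitProj X) (d.param u) :=
    ((hX.contMDiff_orbitProj hchr) _).mdifferentiableAt (by simp)
  have hσ : MDifferentiableAt (𝓡 3) (𝓡 4) d.param u :=
    (d.contMDiffOn_param.contMDiffAt (d.isOpen_dom.mem_nhds hu)).mdifferentiableAt (by simp)
  rw [hfun, mfderiv_comp u hπ hσ]
  exact hX.quotientMetricVal_mfderiv_orbitProj hchr (d.param u) _ _

/-- **The quotient metric is smooth: its coordinate expression in every slice chart is `C^∞`.**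
With `d`, `e`, `σ` as in `quotientMetricVal_chart_symm`, the functions
`u ↦ g_S(e⁻¹ u)(d(e⁻¹)_u a, d(e⁻¹)_u b)` (`a, b ∈ ℝ³`) are `C^∞` on the chart target `d.dom`:
they are Geroch's form along the `C^∞` slice `σ` (`contMDiffOn_orbitBilin_mfderiv`; `g(X, X) < 0`).
Anderson 2000, §0 ("induces a Riemannian metric `g_S` on `S`"). [cite: Anderson2000, §0] -/
theorem IsStationaryKilling.contMDiffOn_quotientMetricVal_chart_symm
    (hX : 𝓢.IsStationaryKilling X univ) (hchr : 𝓢.metric.IsChronological 𝓢.timeOrientation)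
    {p : 𝓢.carrier} (d : LorentzianMetric.SliceData X hX.flow (EuclideanSpace ℝ (Fin 3)) p)
    (a b : EuclideanSpace ℝ (Fin 3)) :
    letI := hX.orbitSpaceChartedSpace hchr
    ContMDiffOn (𝓡 3) 𝓘(ℝ, ℝ) ∞ (fun u ↦ hX.quotientMetricVal hchr
        ((d.chart hX.contMDiff_one hX.isMIntegralCurve_flow hX.flow_zero).symm u)
        (mfderiv (𝓡 3) (𝓡 3) (d.chart hX.contMDiff_one hX.isMIntegralCurve_flow hX.flow_zero).symm
          u a)
        (mfderiv (𝓡 3) (𝓡 3) (d.chart hX.contMDiff_one hX.isMIntegralCurve_flow hX.flow_zero).symm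
          u b)) d.dom := by
  letI := hX.orbitSpaceChartedSpace hchr
  have hKK : ∀ u ∈ d.dom, 𝓢.metric.toPseudoRiemannianMetric.sqNorm X (d.param u) ≠ 0 :=
    fun u _ ↦ (hX.isTimelike (mem_univ _)).1.ne
  have h := 𝓢.metric.toPseudoRiemannianMetric.contMDiffOn_orbitBilin_mfderiv d.isOpen_dom
    d.contMDiffOn_param hX.isKillingField.contMDiff hKK a b
  refine h.congr (fun u hu ↦ ?_)
  exact hX.quotientMetricVal_chart_symm hchr d hu a b

end Spacetime

end Literature.Geometry.Lorentzian

end
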